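import Literature.NumberTheory.Automorphic.CDTTheorem712
import Literature.NumberTheory.EllipticCurves.ModFiveCongruenceHesseFamily
import Literature.NumberTheory.EllipticCurves.Fisher2012.HesseFamilyFiveClosedForms
import HarnessLib

/-!
# stub-ideation k2 · GENERATION 14 (FAMILY 2 — RESHAPE) — `stub_switch`, crux `FreyModularity`
# THE BRIDGE: one proof of Fisher 13.2 (i), n = 5, discharges BOTH registered formulations, and the
# δ-closers of the landing.

Companion of `STUB-IDEAS-stub_switch-2.md` (gen 14).  New helper statements of this generation:

* H1a/H1b `C4_eq_eval_hesseC4`, `C6_eq_eval_hesseC6` — the ABC-side Hesse polynomials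
  (`HesseFamilyFive.C4/C6`, `ModFiveCongruenceHessePolynomials.lean`, quotients of derivative forms)
  ARE the BSD-side ones (`Fisher2012.hesseC4/C6`, `MvPolynomial.pderiv` + PROVED closed forms
  `eval_hesseC4/eval_hesseC6`).  Pure `ring` identities of degree 20 / 30.
* H1 `member_eq_hessePencil5` — hence the two pencils are the SAME Weierstrass curves.
* H2/H2' — `HesseFamilyFive.thm132_geomTorsionFive_of_hesseFamily ↔ Fisher2012.thm132_fiveCongruent_hessePencil`
  (the ABC named fact F1 and the BSD named fact F1′, ~30 BSD Theorems consumers).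
* H4 `stub_switch_of_CDT` — the registered stub header is `BCDT.CDT_three_five_switch` by `δ`.
-/

set_option linter.style.longLine false
set_option linter.dupNamespace false

namespace Summit.ABC.ABC.Cruxes.FreyModularity.StubSwitchK2g14

open Literature.NumberTheory.EllipticCurves Literature.NumberTheory.EllipticCurves.HesseFamilyFive
open Literature.NumberTheory.Automorphic Literature.NumberTheory.Automorphic.BCDT WeierstrassCurve
open Literature.NumberTheory.GaloisRepresentations

/-! ## H1a / H1b — the polynomial bridge (one prover cycle each; `ring` after the closed forms) -/

set_option maxHeartbeats 4000000 in
/-- H1a. [cite: Fisher2012Hessian, §8 (n = 5, display defining 𝔠₄)] -/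
theorem C4_eq_eval_hesseC4 (c₄ c₆ l m : ℚ) :
    C4 c₄ c₆ l m = MvPolynomial.eval ![l, m] (Fisher2012.hesseC4 c₄ c₆) := by
  rw [Fisher2012.eval_hesseC4]
  simp only [C4, Dll, Dmm, Dlm]
  ring

set_option maxHeartbeats 8000000 in
/-- H1b. [cite: Fisher2012Hessian, §8 (n = 5, display defining 𝔠₆)] -/
theorem C6_eq_eval_hesseC6 (c₄ c₆ l m : ℚ) :
    C6 c₄ c₆ l m = MvPolynomial.eval ![l, m] (Fisher2012.hesseC6 c₄ c₆) := by
  rw [Fisher2012.eval_hesseC6]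
  simp only [C6, C4l, C4m, Dl, Dm, Dll, Dmm, Dlm, Dlll, Dllm, Dlmm, Dmmm]
  ring

/-! ## H1 — the two pencils coincide -/

/-- H1. [cite: Fisher2012Hessian, Thm. 13.2 (the family E_{λ,μ})] -/
theorem member_eq_hessePencil5 (c₄ c₆ l m : ℚ) :
    (⟨0, 0, 0, -27 * C4 c₄ c₆ l m, -54 * C6 c₄ c₆ l m⟩ : WeierstrassCurve ℚ) =
      Fisher2012.hessePencil5 c₄ c₆ l m := by
  rw [Fisher2012.hessePencil5, C4_eq_eval_hesseC4, C6_eq_eval_hesseC6]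

/-! ## H2 / H2' — the two registered named facts are equivalent -/

/-- H2: ABC-side F1 ⇒ BSD-side F1′. [cite: Fisher2012Hessian, Thm. 13.2 (i), n = 5] -/
theorem fiveCongruent_hessePencil_of_hesseFamily (hF : thm132_geomTorsionFive_of_hesseFamily) :
    Fisher2012.thm132_fiveCongruent_hessePencil := by
  intro c₄ c₆ l m _ _
  exact hF (Fisher2012.c4c6Model c₄ c₆) (Fisher2012.hessePencil5 c₄ c₆ l m) c₄ c₆ l m rfl
    (member_eq_hessePencil5 c₄ c₆ l m).symm

/-- H2': BSD-side F1′ ⇒ ABC-side F1. [cite: Fisher2012Hessian, Thm. 13.2 (i), n = 5] -/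
theorem hesseFamily_of_fiveCongruent_hessePencil (hF : Fisher2012.thm132_fiveCongruent_hessePencil) :
    thm132_geomTorsionFive_of_hesseFamily := by
  intro E E' iE iE' c₄ c₆ l m hE hE'
  subst hE
  rw [member_eq_hessePencil5] at hE'
  subst hE'
  haveI : (Fisher2012.c4c6Model c₄ c₆).IsElliptic := iE
  exact hF c₄ c₆ l m

/-! ## H4 — the δ-closer: the registered stub header IS `BCDT.CDT_three_five_switch` -/

/-- H4 (shape of the final Theorems closer `theorem stub_switch : <verbatim> := CDT_three_five_switch_holds`). [folklore] -/
theorem stub_switch_of_CDT (h : CDT_three_five_switch) :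
    ∀ (W : WeierstrassCurve ℚ) [W.IsElliptic], ¬ 27 ∣ W.conductorNorm ℤ →
      (∀ ρ₃ : ModPGaloisRep ℚ (ZMod 3) 2, W.IsTorsionGaloisRep 3 ρ₃ →
        ¬ ρ₃.IsAbsIrreducibleOverSqrt (-3)) →
      ∀ (ρ : ModPGaloisRep ℚ (ZMod 5) 2), W.IsTorsionGaloisRep 5 ρ → ρ.IsAbsIrreducibleOverSqrt 5 →
      ∃ (W' : WeierstrassCurve ℚ) (_ : W'.IsElliptic), W'.IsTorsionGaloisRep 5 ρ ∧
        ∃ ρ₃' : ModPGaloisRep ℚ (ZMod 3) 2, W'.IsTorsionGaloisRep 3 ρ₃' ∧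
          ρ₃'.IsAbsIrreducibleOverSqrt (-3) := h

end Summit.ABC.ABC.Cruxes.FreyModularity.StubSwitchK2g14
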